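import Summits.NavierStokesRegularity.FluidComputer.ImplicitMajorant
import HarnessLib

/-!
# Shifted implicit-Euler majorant, row level: squaring chain, interior bound, a-priori closure,
# rebox (layer T of the ramp enclosure, exponential-free form; `pub-fluidc-bp3/R1-DESIGN.md` §6 G9/G10)

HONEST FRAMING (cell `pub-fluidc`, blueprint seat bp3, gen 17): low prior, high value-of-information
experiment on Tao's machine paradigm; NOT a claim that NS blows up. Pure real analysis, continuing
`ImplicitMajorant.lean` (the substep lemma `step` = L1 and its interior form `step_interior`).

CONTENTS (all sorry-free): `macroRow` (= L2: on `[T₀, T₀ + 2^S h]`, `2^S` substeps of `step` composed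
by `S` certified squarings of the augmented affine map — `A 0 ≥ ηE`, `b 0 ≥ ηE(hη'φ)` (entrywise; rounding up allowed),
`Σⱼ A n i j · A n j k ≤ A (n+1) i k`, `Σⱼ A n i j · b n j + b n i ≤ b (n+1) i` — gives
`|z(T₀ + 2^S h)| ≤ A S u + b S`) · `rowInterior` (the NO-DECAY chain, `A 0 ≥ E`, `A n ≥ I`, bounds
`|z(s)|` at every `s ∈ [T₀, T₁]`, `T₁ ≤ T₀ + 2^S h`, from hypotheses on `[T₀, T₁]` only; truncated
substeps handled inside) · `rowClosure` (the a-priori piece bound `W̄`: the forcing bound is assumed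
only while `|z| ≤ W̄` has held — this is how `φ = φ(W̄)` arises from the quadratic term — and a
certified interior bound strictly below `W̄` makes everything unconditional; continuity / exit
principle on `Literature.Analysis.ODE.MaximalTime`) · `rebox` (`|z⁺ᵢ| ≤ Σₖ |Mᵢₖ| uₖ` at a frame
switch). What the kernel supplies per macro row: the dyadic tables with `decide`-checked entrywise
inequalities, the strict row `A' S u + b' S < W̄`, and the analytic inputs `hK`, `hf` of `step`.

References: folklore (continuity method; M-matrices / implicit Euler for Metzler systems), cf.
T. Tao, *Nonlinear dispersive equations*, CBMS 106 (2006), §1.3.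

[cite: Tao2016AveragedNS, §5.5 Thm 5.3 (5.5)]
-/

noncomputable section

open Set Real Filter Topology

namespace Summit.NavierStokesRegularity.FluidComputer

namespace ImplicitMajorant

open Literature.Analysis.ODE

variable {ι : Type*} [Fintype ι] [DecidableEq ι]

/-- **L2, the macro row by repeated squaring.** On a piece `[T₀, T₀ + 2^S h]` where the data of `step`
(`B`, `φ`, `E`, `η`, `η'`) are valid throughout, a chain of matrices / vectors `A n`, `b n` with
`A 0 ≥ ηE`, `b 0 ≥ η E (h η' φ)` (entrywise, so rounded-up tables qualify) and the ENTRYWISE certificates `A n · A n ≤ A (n+1)`,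
`A n · b n + b n ≤ b (n+1)` (what the kernel checks by `decide` after rounding each square up) bounds
the state after `2^S` substeps: `|zᵢ(T₀ + 2^S h)| ≤ Σₖ (A S)ᵢₖ uₖ + (b S)ᵢ`. [folklore] -/
theorem macroRow {z : ℝ → ι → ℝ} {K : ℝ → ι → ι → ℝ} {f : ℝ → ι → ℝ}
    {B E : ι → ι → ℝ} {φ u : ι → ℝ} {T₀ h c η η' : ℝ} (S : ℕ)
    (A : ℕ → ι → ι → ℝ) (b : ℕ → ι → ℝ)
    (hh : 0 < h) (hc : 0 ≤ c)
    (hzc : ∀ i, ContinuousOn (fun s => z s i) (Icc T₀ (T₀ + 2 ^ S * h)))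
    (hz : ∀ s ∈ Ico T₀ (T₀ + 2 ^ S * h), ∀ i,
      HasDerivWithinAt (fun r => z r i) (∑ j, K s i j * z s j + f s i) (Ici s) s)
    (hK : ∀ s ∈ Ico T₀ (T₀ + 2 ^ S * h), ∀ i j, |K s i j + (if i = j then c else 0)| ≤ B i j)
    (hf : ∀ s ∈ Ico T₀ (T₀ + 2 ^ S * h), ∀ i, |f s i| ≤ φ i)
    (hE0 : ∀ i k, 0 ≤ E i k)
    (hE : ∀ w : ι → ℝ, (∀ k, 0 ≤ w k) →
      ∀ i, w i + h * ∑ j, B i j * (∑ k, E j k * w k) ≤ ∑ k, E i k * w k)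
    (hη : exp (-(c * h)) ≤ η) (hη' : exp (c * h) ≤ η')
    (hA0 : ∀ i k, η * E i k ≤ A 0 i k)
    (hb0 : ∀ i, η * ∑ k, E i k * (h * (η' * φ k)) ≤ b 0 i)
    (hAsq : ∀ n < S, ∀ i k, ∑ j, A n i j * A n j k ≤ A (n + 1) i k)
    (hbsq : ∀ n < S, ∀ i, ∑ j, A n i j * b n j + b n i ≤ b (n + 1) i)
    (hu : ∀ i, |z T₀ i| ≤ u i) :
    ∀ i, |z (T₀ + 2 ^ S * h) i| ≤ ∑ k, A S i k * u k + b S i := by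
  classical
  have h2pow : ∀ n : ℕ, (0:ℝ) < 2 ^ n * h := fun n => mul_pos (pow_pos two_pos n) hh
  -- Q n : the level-n map bounds 2^n substeps from any start inside the piece
  have Q : ∀ n, n ≤ S → ∀ (t' : ℝ) (u' : ι → ℝ), T₀ ≤ t' → t' + 2 ^ n * h ≤ T₀ + 2 ^ S * h →
      (∀ i, |z t' i| ≤ u' i) → ∀ i, |z (t' + 2 ^ n * h) i| ≤ ∑ k, A n i k * u' k + b n i := by
    intro n
    induction n with
    | zero =>
      intro _ t' u' ht' hend hu' i
      have hend' : t' + h ≤ T₀ + 2 ^ S * h := by simpa using hend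
      have hsubc : Icc t' (t' + h) ⊆ Icc T₀ (T₀ + 2 ^ S * h) := Icc_subset_Icc ht' hend'
      have hsubo : Ico t' (t' + h) ⊆ Ico T₀ (T₀ + 2 ^ S * h) := Ico_subset_Ico ht' hend'
      have hstep := step (t₀ := t') hh hc (fun i => (hzc i).mono hsubc)
        (fun s hs i => hz s (hsubo hs) i) (fun s hs i j => hK s (hsubo hs) i j)
        (fun s hs i => hf s (hsubo hs) i) hE0 hE hη hη' hu' i
      have hu'0 : ∀ k, 0 ≤ u' k := fun k => (abs_nonneg _).trans (hu' k)
      have hrw : η * ∑ k, E i k * (u' k + h * (η' * φ k))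
          = ∑ k, (η * E i k) * u' k + η * ∑ k, E i k * (h * (η' * φ k)) := by
        rw [Finset.mul_sum, Finset.mul_sum, ← Finset.sum_add_distrib]
        exact Finset.sum_congr rfl fun k _ => by ring
      have hle : ∑ k, (η * E i k) * u' k ≤ ∑ k, A 0 i k * u' k :=
        Finset.sum_le_sum fun k _ => mul_le_mul_of_nonneg_right (hA0 i k) (hu'0 k)
      have h0 := hstep
      rw [hrw] at h0
      simpa using h0.trans (add_le_add hle (hb0 i))
    | succ n ih =>
      intro hn t' u' ht' hend hu' i
      have hnS : n < S := Nat.lt_of_succ_le hn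
      have hnS' : n ≤ S := hnS.le
      have hpow : (2:ℝ) ^ (n + 1) * h = 2 ^ n * h + 2 ^ n * h := by rw [pow_succ]; ring
      have hmid : t' + 2 ^ n * h ≤ T₀ + 2 ^ S * h := by
        have := h2pow n; linarith [hend, hpow]
      -- first half
      have h1 : ∀ k, |z (t' + 2 ^ n * h) k| ≤ ∑ j, A n k j * u' j + b n k :=
        ih hnS' t' u' ht' hmid hu'
      -- second half, started from the first half's bound
      have ht'' : T₀ ≤ t' + 2 ^ n * h := by have := h2pow n; linarith
      have hend'' : t' + 2 ^ n * h + 2 ^ n * h ≤ T₀ + 2 ^ S * h := by linarith [hend, hpow]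
      have h2 := ih hnS' (t' + 2 ^ n * h) (fun k => ∑ j, A n k j * u' j + b n k) ht'' hend'' h1 i
      have htime : t' + 2 ^ (n + 1) * h = t' + 2 ^ n * h + 2 ^ n * h := by rw [hpow]; ring
      rw [htime]
      refine h2.trans ?_
      -- Σ_k A n i k (Σ_j A n k j u'_j + b n k) + b n i ≤ Σ_j A (n+1) i j u'_j + b (n+1) i
      have hu'0 : ∀ j, 0 ≤ u' j := fun j => (abs_nonneg _).trans (hu' j)
      have halg : ∑ k, A n i k * (∑ j, A n k j * u' j + b n k) + b n i
          = ∑ j, (∑ k, A n i k * A n k j) * u' j + (∑ k, A n i k * b n k + b n i) := by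
        have : ∑ k, A n i k * (∑ j, A n k j * u' j + b n k)
            = ∑ j, (∑ k, A n i k * A n k j) * u' j + ∑ k, A n i k * b n k := by
          simp only [mul_add, Finset.sum_add_distrib, Finset.mul_sum, Finset.sum_mul]
          congr 1
          rw [Finset.sum_comm]
          exact Finset.sum_congr rfl fun j _ => Finset.sum_congr rfl fun k _ => by ring
        rw [this]; ring
      rw [halg]
      have hAu : ∑ j, (∑ k, A n i k * A n k j) * u' j ≤ ∑ j, A (n + 1) i j * u' j :=
        Finset.sum_le_sum fun j _ => mul_le_mul_of_nonneg_right (hAsq n hnS i j) (hu'0 j)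
      have hb := hbsq n hnS i
      linarith
  exact Q S le_rfl T₀ u le_rfl le_rfl hu

/-- **Interior bound over a (possibly truncated) macro row by the NO-DECAY chain.** With `A 0 ≥ E`,
`b 0 = E (h η' φ)`, the squaring certificates, and `A n ≥ I`, `b n ≥ 0` (trivial `decide` checks), the
level-`S` quantity `A S u + b S` bounds `|z(s)|` at EVERY time `s` of `[T₀, T₁]`,
`T₁ ≤ T₀ + 2^S h`, from hypotheses on `[T₀, T₁]` only — the form needed by the continuation
argument for the a-priori piece bound (`rowClosure`). [folklore] -/
theorem rowInterior {z : ℝ → ι → ℝ} {K : ℝ → ι → ι → ℝ} {f : ℝ → ι → ℝ}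
    {B E : ι → ι → ℝ} {φ u : ι → ℝ} {T₀ T₁ h c η' : ℝ} (S : ℕ)
    (A : ℕ → ι → ι → ℝ) (b : ℕ → ι → ℝ)
    (hh : 0 < h) (hc : 0 ≤ c) (hT₁ : T₀ ≤ T₁) (hT₁' : T₁ ≤ T₀ + 2 ^ S * h)
    (hzc : ∀ i, ContinuousOn (fun s => z s i) (Icc T₀ T₁))
    (hz : ∀ s ∈ Ico T₀ T₁, ∀ i,
      HasDerivWithinAt (fun r => z r i) (∑ j, K s i j * z s j + f s i) (Ici s) s)
    (hK : ∀ s ∈ Ico T₀ T₁, ∀ i j, |K s i j + (if i = j then c else 0)| ≤ B i j)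
    (hf : ∀ s ∈ Ico T₀ T₁, ∀ i, |f s i| ≤ φ i)
    (hB0 : ∀ i j, 0 ≤ B i j) (hφ0 : ∀ i, 0 ≤ φ i)
    (hE0 : ∀ i k, 0 ≤ E i k)
    (hE : ∀ w : ι → ℝ, (∀ k, 0 ≤ w k) →
      ∀ i, w i + h * ∑ j, B i j * (∑ k, E j k * w k) ≤ ∑ k, E i k * w k)
    (hη' : exp (c * h) ≤ η')
    (hA0 : ∀ i k, E i k ≤ A 0 i k)
    (hb0 : ∀ i, ∑ k, E i k * (h * (η' * φ k)) ≤ b 0 i)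
    (hAsq : ∀ n < S, ∀ i k, ∑ j, A n i j * A n j k ≤ A (n + 1) i k)
    (hbsq : ∀ n < S, ∀ i, ∑ j, A n i j * b n j + b n i ≤ b (n + 1) i)
    (hAI : ∀ n ≤ S, ∀ i k, (if i = k then (1:ℝ) else 0) ≤ A n i k)
    (hbn : ∀ n ≤ S, ∀ i, 0 ≤ b n i)
    (hu : ∀ i, |z T₀ i| ≤ u i) :
    ∀ s ∈ Icc T₀ T₁, ∀ i, |z s i| ≤ ∑ k, A S i k * u k + b S i := by
  classical
  have h2pow : ∀ n : ℕ, (0:ℝ) < 2 ^ n * h := fun n => mul_pos (pow_pos two_pos n) hh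
  have hη'0 : 0 ≤ η' := (exp_pos _).le.trans hη'
  have hAn0 : ∀ n ≤ S, ∀ i k, 0 ≤ A n i k := fun n hn i k =>
    le_trans (by split_ifs <;> norm_num) (hAI n hn i k)
  -- inflation: x ≤ A n x + b n for x ≥ 0
  have hinfl : ∀ n ≤ S, ∀ x : ι → ℝ, (∀ k, 0 ≤ x k) → ∀ i, x i ≤ ∑ k, A n i k * x k + b n i := by
    intro n hn x hx i
    have h1 : ∑ k, (if i = k then (1:ℝ) else 0) * x k ≤ ∑ k, A n i k * x k :=
      Finset.sum_le_sum fun k _ => mul_le_mul_of_nonneg_right (hAI n hn i k) (hx k)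
    have h2 : ∑ k, (if i = k then (1:ℝ) else 0) * x k = x i := by
      simp [ite_mul, Finset.sum_ite_eq, Finset.mem_univ]
    linarith [hbn n hn i]
  -- composition algebra
  have halg : ∀ n (x : ι → ℝ) i, ∑ k, A n i k * (∑ j, A n k j * x j + b n k) + b n i
      = ∑ j, (∑ k, A n i k * A n k j) * x j + (∑ k, A n i k * b n k + b n i) := by
    intro n x i
    have : ∑ k, A n i k * (∑ j, A n k j * x j + b n k)
        = ∑ j, (∑ k, A n i k * A n k j) * x j + ∑ k, A n i k * b n k := by
      simp only [mul_add, Finset.sum_add_distrib, Finset.mul_sum, Finset.sum_mul]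
      congr 1
      rw [Finset.sum_comm]
      exact Finset.sum_congr rfl fun j _ => Finset.sum_congr rfl fun k _ => by ring
    rw [this]; ring
  have hcomp : ∀ n < S, ∀ x : ι → ℝ, (∀ j, 0 ≤ x j) → ∀ i,
      ∑ k, A n i k * (∑ j, A n k j * x j + b n k) + b n i ≤ ∑ j, A (n + 1) i j * x j + b (n + 1) i := by
    intro n hn x hx i
    rw [halg]
    have hAu : ∑ j, (∑ k, A n i k * A n k j) * x j ≤ ∑ j, A (n + 1) i j * x j :=
      Finset.sum_le_sum fun j _ => mul_le_mul_of_nonneg_right (hAsq n hn i j) (hx j)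
    linarith [hbsq n hn i]
  -- Q n
  have Q : ∀ n, n ≤ S → ∀ (t' : ℝ) (u' : ι → ℝ), T₀ ≤ t' → t' ≤ T₁ →
      (∀ i, |z t' i| ≤ u' i) → ∀ s ∈ Icc t' T₁, s ≤ t' + 2 ^ n * h →
      ∀ i, |z s i| ≤ ∑ k, A n i k * u' k + b n i := by
    intro n
    induction n with
    | zero =>
      intro _ t' u' ht' ht'T hu' s hs hsn i
      have hu'0 : ∀ k, 0 ≤ u' k := fun k => (abs_nonneg _).trans (hu' k)
      rcases eq_or_lt_of_le hs.1 with heq | hlt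
      · -- s = t'
        rw [← heq]
        exact (hu' i).trans (hinfl 0 (Nat.zero_le _) u' hu'0 i)
      · -- t' < s ≤ min (t' + h) T₁: truncated substep of length h'' = s - t'
        have hsn' : s ≤ t' + h := by simpa using hsn
        set h'' := s - t' with hh''_def
        have hh'' : 0 < h'' := by simp only [hh''_def]; linarith
        have hh''le : h'' ≤ h := by simp only [hh''_def]; linarith
        have hs_eq : s = t' + h'' := by simp only [hh''_def]; ring
        have hsubc : Icc t' (t' + h'') ⊆ Icc T₀ T₁ := by
          rw [← hs_eq]; exact Icc_subset_Icc ht' hs.2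
        have hsubo : Ico t' (t' + h'') ⊆ Ico T₀ T₁ := by
          rw [← hs_eq]; exact Ico_subset_Ico ht' hs.2
        have hE'' : ∀ w : ι → ℝ, (∀ k, 0 ≤ w k) →
            ∀ i, w i + h'' * ∑ j, B i j * (∑ k, E j k * w k) ≤ ∑ k, E i k * w k := by
          intro w hw i
          have hBw : 0 ≤ ∑ j, B i j * (∑ k, E j k * w k) := Finset.sum_nonneg fun j _ =>
            mul_nonneg (hB0 i j) (Finset.sum_nonneg fun k _ => mul_nonneg (hE0 j k) (hw k))
          have := hE w hw i
          nlinarith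
        have hη'' : exp (c * h'') ≤ η' := (exp_le_exp.2 (by nlinarith)).trans hη'
        have hint := step_interior (t₀ := t') hh'' hc (fun i => (hzc i).mono hsubc)
          (fun r hr i => hz r (hsubo hr) i) (fun r hr i j => hK r (hsubo hr) i j)
          (fun r hr i => hf r (hsubo hr) i) hE0 hE'' hη'' hu' s
          (by rw [hs_eq]; exact ⟨by linarith, le_rfl⟩) i
        refine hint.trans ?_
        have h1 : ∑ k, E i k * (u' k + h'' * (η' * φ k))
            ≤ ∑ k, E i k * u' k + ∑ k, E i k * (h * (η' * φ k)) := by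
          rw [← Finset.sum_add_distrib]
          refine Finset.sum_le_sum fun k _ => ?_
          have : E i k * (u' k + h'' * (η' * φ k)) ≤ E i k * (u' k + h * (η' * φ k)) :=
            mul_le_mul_of_nonneg_left (by nlinarith [mul_nonneg hη'0 (hφ0 k)]) (hE0 i k)
          linarith [mul_add (E i k) (u' k) (h * (η' * φ k))]
        have h2 : ∑ k, E i k * u' k ≤ ∑ k, A 0 i k * u' k :=
          Finset.sum_le_sum fun k _ => mul_le_mul_of_nonneg_right (hA0 i k) (hu'0 k)
        linarith [hb0 i]
    | succ n ih =>
      intro hn t' u' ht' ht'T hu' s hs hsn i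
      have hnS : n < S := Nat.lt_of_succ_le hn
      have hnS' : n ≤ S := hnS.le
      have hu'0 : ∀ k, 0 ≤ u' k := fun k => (abs_nonneg _).trans (hu' k)
      have hpow : (2:ℝ) ^ (n + 1) * h = 2 ^ n * h + 2 ^ n * h := by rw [pow_succ]; ring
      set x : ι → ℝ := fun k => ∑ j, A n k j * u' j + b n k with hx_def
      have hx0 : ∀ k, 0 ≤ x k := fun k => by
        have := hinfl n hnS' u' hu'0 k; exact (hu'0 k).trans this
      rcases le_or_gt s (t' + 2 ^ n * h) with hle | hgt
      · -- inside the first half: inflate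
        have h1 : |z s i| ≤ x i := ih hnS' t' u' ht' ht'T hu' s hs hle i
        exact h1.trans ((hinfl n hnS' x hx0 i).trans (hcomp n hnS u' hu'0 i))
      · -- beyond the midpoint m = t' + 2^n h
        have hmT : t' + 2 ^ n * h ≤ T₁ := hgt.le.trans hs.2
        have hm1 : ∀ k, |z (t' + 2 ^ n * h) k| ≤ x k :=
          ih hnS' t' u' ht' ht'T hu' (t' + 2 ^ n * h) ⟨by have := h2pow n; linarith, hmT⟩ le_rfl
        have h2 := ih hnS' (t' + 2 ^ n * h) x (by have := h2pow n; linarith) hmT hm1 s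
          ⟨hgt.le, hs.2⟩ (by linarith [hpow]) i
        exact h2.trans (hcomp n hnS u' hu'0 i)
  intro s hs i
  exact Q S le_rfl T₀ u le_rfl hT₁ hu s hs (hs.2.trans hT₁') i

/-- **The a-priori piece bound by continuity (`W̄` closure).** Same data as `rowInterior`, but the
forcing bound `|f(s)| ≤ φ` is only assumed AS LONG AS `|z| ≤ W̄` has held up to time `s` (this is how
the quadratic term of the deviation equation is bounded: `φ` is evaluated at the a-priori widths `W̄`).
If the certified no-decay level-`S` bound is STRICTLY below `W̄` (a `decide` check), then it holds
unconditionally on the whole row — hence so does `|f| ≤ φ`, and `macroRow` applies. [folklore] -/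
theorem rowClosure {z : ℝ → ι → ℝ} {K : ℝ → ι → ι → ℝ} {f : ℝ → ι → ℝ}
    {B E : ι → ι → ℝ} {φ u : ι → ℝ} {T₀ T₁ h c η' : ℝ} (S : ℕ)
    (A : ℕ → ι → ι → ℝ) (b : ℕ → ι → ℝ) (Wbar : ι → ℝ)
    (hh : 0 < h) (hc : 0 ≤ c) (hT₁ : T₀ ≤ T₁) (hT₁' : T₁ ≤ T₀ + 2 ^ S * h)
    (hzc : ∀ i, ContinuousOn (fun s => z s i) (Icc T₀ T₁))
    (hz : ∀ s ∈ Ico T₀ T₁, ∀ i,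
      HasDerivWithinAt (fun r => z r i) (∑ j, K s i j * z s j + f s i) (Ici s) s)
    (hK : ∀ s ∈ Ico T₀ T₁, ∀ i j, |K s i j + (if i = j then c else 0)| ≤ B i j)
    (hf : ∀ s ∈ Ico T₀ T₁, (∀ r ∈ Icc T₀ s, ∀ i, |z r i| ≤ Wbar i) → ∀ i, |f s i| ≤ φ i)
    (hB0 : ∀ i j, 0 ≤ B i j) (hφ0 : ∀ i, 0 ≤ φ i)
    (hE0 : ∀ i k, 0 ≤ E i k)
    (hE : ∀ w : ι → ℝ, (∀ k, 0 ≤ w k) →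
      ∀ i, w i + h * ∑ j, B i j * (∑ k, E j k * w k) ≤ ∑ k, E i k * w k)
    (hη' : exp (c * h) ≤ η')
    (hA0 : ∀ i k, E i k ≤ A 0 i k)
    (hb0 : ∀ i, ∑ k, E i k * (h * (η' * φ k)) ≤ b 0 i)
    (hAsq : ∀ n < S, ∀ i k, ∑ j, A n i j * A n j k ≤ A (n + 1) i k)
    (hbsq : ∀ n < S, ∀ i, ∑ j, A n i j * b n j + b n i ≤ b (n + 1) i)
    (hAI : ∀ n ≤ S, ∀ i k, (if i = k then (1:ℝ) else 0) ≤ A n i k)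
    (hbn : ∀ n ≤ S, ∀ i, 0 ≤ b n i)
    (hW : ∀ i, ∑ k, A S i k * u k + b S i < Wbar i)
    (hu : ∀ i, |z T₀ i| ≤ u i) :
    ∀ s ∈ Icc T₀ T₁, ∀ i, |z s i| ≤ ∑ k, A S i k * u k + b S i := by
  classical
  have hu0 : ∀ k, 0 ≤ u k := fun k => (abs_nonneg _).trans (hu k)
  -- inflation at level S: u ≤ A S u + b S
  have hinflS : ∀ i, u i ≤ ∑ k, A S i k * u k + b S i := by
    intro i
    have h1 : ∑ k, (if i = k then (1:ℝ) else 0) * u k ≤ ∑ k, A S i k * u k :=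
      Finset.sum_le_sum fun k _ => mul_le_mul_of_nonneg_right (hAI S le_rfl i k) (hu0 k)
    have h2 : ∑ k, (if i = k then (1:ℝ) else 0) * u k = u i := by
      simp [ite_mul, Finset.sum_ite_eq, Finset.mem_univ]
    linarith [hbn S le_rfl i]
  let P : ℝ → Prop := fun t => ∀ i, |z t i| ≤ Wbar i
  have hPa : P T₀ := fun i => ((hu i).trans (hinflS i)).trans (hW i).le
  have hclosed : ∀ t ∈ Ioc T₀ T₁, (∀ s ∈ Ico T₀ t, P s) → P t := by
    intro t ht hP i
    exact le_const_of_forall_Ico ((hzc i).abs) ht fun s hs => hP s hs i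
  set T := maximalTimeP P T₀ T₁ with hT_def
  have hTmem : T ∈ Icc T₀ T₁ := maximalTimeP_mem hT₁ hPa
  have hPT : ∀ t ∈ Icc T₀ T, P t := fun t ht => maximalTimeP_spec hT₁ hPa hclosed ht
  -- on [T₀, T] the forcing bound is unconditional, so rowInterior applies there
  have hsubc : Icc T₀ T ⊆ Icc T₀ T₁ := Icc_subset_Icc_right hTmem.2
  have hsubo : Ico T₀ T ⊆ Ico T₀ T₁ := Ico_subset_Ico_right hTmem.2
  have hfT : ∀ s ∈ Ico T₀ T, ∀ i, |f s i| ≤ φ i := fun s hs =>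
    hf s (hsubo hs) fun r hr => hPT r ⟨hr.1, hr.2.trans hs.2.le⟩
  have hrow := rowInterior S A b hh hc hTmem.1 (hTmem.2.trans hT₁') (fun i => (hzc i).mono hsubc)
    (fun s hs i => hz s (hsubo hs) i) (fun s hs i j => hK s (hsubo hs) i j) hfT hB0 hφ0 hE0 hE hη'
    hA0 hb0 hAsq hbsq hAI hbn hu
  -- exit principle: T = T₁
  have hT : T = T₁ := by
    rcases maximalTimeP_exit hT₁ hPa with h1 | h1
    · exact h1
    · exfalso
      apply h1
      have : ∀ i, ∀ᶠ t in 𝓝[Icc T₀ T₁] T, |z t i| ≤ Wbar i := by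
        intro i
        have hlt : |z T i| < Wbar i := (hrow T ⟨hTmem.1, le_rfl⟩ i).trans_lt (hW i)
        have hcw : ContinuousWithinAt (fun s => |z s i|) (Icc T₀ T₁) T := ((hzc i).abs) T hTmem
        exact (hcw.eventually_lt_const hlt).mono fun _ h => h.le
      exact Filter.eventually_all.2 this
  intro s hs i
  exact hrow s ⟨hs.1, hT.symm ▸ hs.2⟩ i

omit [DecidableEq ι] in
/-- **Rebox at a frame switch.** If the new coordinates are a fixed linear image of the old ones,
`z⁺ᵢ = Σₖ Mᵢₖ z⁻ₖ`, then `|z⁻| ≤ u` componentwise gives `|z⁺ᵢ| ≤ Σₖ |Mᵢₖ| uₖ`. [folklore] -/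
theorem rebox {M : ι → ι → ℝ} {zm zp u : ι → ℝ} (hM : ∀ i, zp i = ∑ k, M i k * zm k)
    (hu : ∀ k, |zm k| ≤ u k) : ∀ i, |zp i| ≤ ∑ k, |M i k| * u k := by
  intro i
  rw [hM i]
  refine (Finset.abs_sum_le_sum_abs _ _).trans (Finset.sum_le_sum fun k _ => ?_)
  rw [abs_mul]
  exact mul_le_mul_of_nonneg_left (hu k) (abs_nonneg _)

end ImplicitMajorant

end Summit.NavierStokesRegularity.FluidComputer
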